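import Summits.ResolutionOfSingularities.ResolutionOfSingularities.Theorems.CuspCutCells2
import HarnessLib

/-!
# FaceCutKernels — decomp-res node «FaceCut» (lens-2 g26, critic row 208 CLEARED), tree file 1/6 of the node

Content VERBATIM from the decomp-res lens-2 g26 node `HOME/decomp-res-lens-2/g26/FaceCut.lean` (pin dd1d04c7, 1254
l; HOME = run/shared/lean/pub/decomp-res): NO carry — the node imports the LANDED tree only (the g24 node «CuspCut»
= `…Theorems.CuspCutKernels`…`3` · `…Theorems.CuspCutCells`/`2` · `…Theorems.MaxContactCutCuspCut`, landed
2026-08-31 by writer g13); every declaration is new; namespace `…Theses.FaceCut` ↦ `…Theorems.FaceCut` (same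
renaming as CuspCut / OddCrossCut), sub-namespace `FaceX` kept.  Farm (node; lens + critic runs): rc 0 · 0 err · 0
warn · 0 sorry · std axioms (no `native_decide`).  Critic: CRITIC-LEDGER row 208 «FaceCut» CLEARED (PRICED DELIVERY
under rows 197/200 (a-wild) and PRICING 09:54:29Z (f1)–(f7)): ONE PRE-STATED WHOLE STRUCTURAL SUB-KIND of the wild
cusp class — the quasi-homogeneous (5,3)-FACE CUSP CURVES WITH ALL TAILS `IsUniformFaceCuspCurve` (letter `FaceShape
c v f`: `f − z̃² − e₁u₁⁵ − e₂v³u₂⁵ − e₀u₂⁷ ∈ faceTail c v`, units `e₀ e₁ e₂`, every monomial of face weight `105a +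
42i + 30j + 20l > 210` allowed) — DECIDED (`FaceCuspExit`: paper NODE-g26 §1–§6 + the kernel cores of §F.0: the face
tree as data audited by `decide` (`faceCheck_eq_true`, `faceCheckExtra_*`), the 39 chart identities `face_e0…e38`
with unit-square coefficients, the tail / Artin–Schreier transports `transport_*`, the 56 tail-robust leaf
certificates `face_leaf*`, the dictionary `face_tower` / `face_towerMonomial` / `face_weight_iff`,
`insepV3_faceLetter` / `insepV3_faceRoot` — INSEP-v³ is a face cusp), complement EXACT and HONEST:
`cuspExit_iff_face : CuspExit ⟺ FaceCuspExit ∧ NonFaceCuspExit` (hyp-free), the NEW LOCATED RESIDUAL ENGINE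
**`NonFaceCuspExit`** (UNDECIDED · HYP · no inhabitant certified), `CuspX.CuspSpecialRung` untouched.  Landing
orders = the lens LANDING NOTE INBOX :1364 endorsed by the critic rider INBOX 2026-08-31T10:41:11Z: (K)
`FaceCutKernels*` = §F.0 (ring level, `section FaceRing`; cut by the 400-line cap), (C) `FaceCutCells*` = §F.1
(scheme level: the face letter, the sub-kind, the cells `FaceCuspExit` [DECIDED-ON-PAPER] / `NonFaceCuspExit`
[UNDECIDED · HYP], `cuspExit_iff_face`, `IsFaceCurvePt`), (X) `MaxContactCutFaceCut` = §F.2 (`namespace FaceX`: the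
wiring BY NAME on the host route — Theses cone); all VERBATIM, `--kind proof --supports
stmt-ResolutionOfSingularities-29273`; route MaxContactCut: lens-2's aside STAYS 33866 `LeafSpecialRung` — NO switch
(cone rule).  The `def … : Prop` declarations (`FaceShape`, `IsFaceCuspAt`, `IsUniformFaceCuspCurve`,
`FaceCuspExit`, `NonFaceCuspExit`, `IsFaceCurvePt`) are THIS node's letters / classes / cells /
engines-as-hypotheses (cn26) — none is a vendored fact; `FMono` / `FaceNode` are plain data `structure`s of the
audited face tree.

The lens header, verbatim:

> # FaceCut — decomp-res lens-2 («structural dichotomy (special vs generic)») g26: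
> # ONE PRE-STATED STRUCTURAL SUB-KIND OF THE WILD CUSP CLASS, DECIDED — the quasi-homogeneous (5,3)-face cusps WITH ALL TAILS
>
> COLUMN TARGET (BY NAME): `MaxContactCut.RungOne : E 2 → E 1` (tree item stmt-ResolutionOfSingularities-29273; lens-2 aside
> 33866 `MaxContactCut.LeafSpecialRung`).  Host: the LANDED g24 node (`Theorems.CuspCutKernels*`, `Theorems.CuspCutCells*`,
> `Theorems.MaxContactCutCuspCut`; imported, nothing carried): `CuspX.rungOne_iff : RungOne ⟺ CuspGenericRung ∧
CuspSpecialRung`,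
> the decided generic half `CuspX.cuspGenericRung_of_ports … (hCuE : CuspExit) …` with the wild engine `CuspExit` a HYPOTHESIS
> (undecided for the class; decided by g24 for the certified inhabitant INSEP-v³ only).  Critic window row 200 (a-wild), priced
> in advance (STATUS `PRICING … 09:54:29Z`, INBOX :1318): «ONE pre-stated whole structural sub-kind ∋ INSEP-v³ ONCE, complement
> exact + honest; do not widen (one characteristic pair = one face)».
>
> ## THE SUB-KIND (stated in advance BY LETTER — §F.1; pre-pricing ask INBOX :1307)
>
> Inside g24's `IsUniformCuspCurve I n m η` (marking `n = 2`, a curve point `η`, every closed point `y` of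
`closure{η}` of residue
> characteristic `2` and `IsCuspAt I m η y`): the **FACE CUSP CURVES** `IsUniformFaceCuspCurve I n m η` :=
> `IsUniformCuspCurve I n m η ∧ ∀ closed y ⤳ η, IsSpreadAt I n m η y ∨ IsFaceCuspAt I m η y` — every closed point is EITHER a
> g19 SPREAD point (secondary curve relatively SIMPLE over `y`: it exits by the tower alone, g19/g24 NODE §1.2 — e.g. the points
> `y_α ≠ y₀` of INSEP-v³'s top curve) OR a **(5,3)-FACE CUSP point**: `IsFaceCuspAt I m η y` := g24's `IsCuspAt` frame
> `(h, c = (z̃,u₁,u₂), v, g, f, G)` (curve prime `(c)`, `𝔪_y = (c, v)`, `edim = 4`, `I_y = (f)` principal,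
`CuspShape … c G g f m`)
> with `m = 5`, the EQUICHARACTERISTIC GUARD `ringChar 𝒪_{Y,y} = 2` (automatic over a field of characteristic 2:
> `ringChar_eq_two_of_algebra`; it makes `𝒪̂_{Y,y}` an equal-characteristic complete regular local ring) and the FACE LETTER
>
>   `FaceShape c v f`:  `f − z̃² − e₁·u₁⁵ − e₂·v³·u₂⁵ − e₀·u₂⁷ ∈ faceTail c v`,  `e₀ e₁ e₂` arbitrary UNITS of `𝒪_{Y,y}`,
>
> `faceTail c v` = the ideal spanned by ALL monomials `z̃ᵃu₁ⁱu₂ʲvˡ` of face weight `105a + 42i + 30j + 20l > 210` (the face has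
> weight `210`).  NO residue-field restriction (finite, perfect, `𝔽₂(τ)`, …), NO tail truncation (every monomial above the face,
> every Artin–Schreier term `z̃·(…)`), unit coefficients free.  INSEP-v³ `(X₀ + X₁(X₂+X₃))² + X₂⁵ + X₁³X₃⁵ + X₃⁷`
over `𝔽₂` reads
> the letter at its cusp point `y₀` with `e = (1,1,1)`, tail `0` (`insepV3_faceLetter`, `faceShape_insepV3`; g24
> `represent_INSEPv3`), its imperfect twin `… + τ·X₂⁵ …` with `e = (1,τ,1)` (`faceShape_insepV3_tau`); INSEP-v³'s inhabitant
> conditions are pre-met (g24 `section Pilot`; `2 ∣ 2`, cn30-clean).  The pre-stated tail ideal of the ask (`faceTailPre`, with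
> g24's generator clause `5a + 2(i+j) ≥ 11`) is INSIDE `faceTail` (`faceTailPre_le`): the decided sub-kind contains
the pre-stated
> one (the clause only excluded the above-face quintic terms `vˡu₁ⁱu₂^{5−i}`; for the monomials of `f` it follows
from `CuspShape`).
>
> ## THE DICTIONARY AND THE WEIGHTED NORMAL FORM (NODE-g26 §1–§2; g24 NODE §1 for the tower)
>
> g24's tower (blow up `C`, then `Σ₁`; `q = 2`) reads only the quintic face: over a face-cusp point `y` the unique point of
> `τ = 1` at stage 2 is the cusp point `x̄ ∈ Γ ∩ Σ₂` (`X = 0` of the lower chart; every other point over `y` has order `< 2` or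
> `τ = 3`).  `𝒪_{X₂,x̄}` is regular of dimension 4 with the regular system of parameters `(Z, u, s, t) = (z̃/u₂²,
u₂, u₁/u₂, v)`;
> by the guard and COHEN'S STRUCTURE THEOREM (equal characteristic: a coefficient field `k′ ≅ κ(x̄) = κ(y)` exists — Matsumura,
> Commutative Ring Theory, Thm 28.3; Cohen 1946) `𝒪̂_{X₂,x̄} = k′⟦Z,u,s,t⟧ ∋ f₂ = u⁻⁴·f`, and a monomial `z̃ᵃu₁ⁱu₂ʲvˡ ↦
> Zᵃu^{2a+i+j−4}sⁱtˡ` (`face_towerMonomial`).  WEIGHTS `w(Z,u,s,t) = (45/2, 15, 6, 10)` = (face weight)/14·…: the face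
> `{u³, us⁵, ut³}` has weight 45 and, by the letter, EVERY other term of `f₂ − Z²` is a `u`-MULTIPLE of weight `> 45`
> (`face_weight_iff`; `u`-divisibility from `CuspShape`: `2a+i+j ≥ 5` off `z̃²`).  A unit `e_i = ē_i + m_i` (`ē_i ∈ k′ˣ`,
> `m_i ∈ 𝔪`) contributes `ē_i·(face monomial)` + terms of weight `> 45`.  LEMMA N (NODE-g26 §2; Weierstrass
preparation w.r.t. `Z`
> in `k′⟦u,s,t⟧⟦Z⟧` — `f₂ ≡ Z² (mod u,s,t)` — ZariskiSamuelII Ch. VII §1 Thm 5 / Bourbaki AC VII §3 no. 8, then: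
lowest-weight parts
> multiply in the weight-graded polynomial ring, and reduction mod `u` + uniqueness of the Weierstrass form of `f₂ ≡
Z² (mod u)`):
>
>   `f₂ = υ·(Z² + B·Z + F)`,  `υ ≡ 1`,  `F = ē₀u³ + ē₁us⁵ + ē₂ut³ + T`,  `T ∈ J₀`,  `B ∈ J^B₀`,  `ē_i ∈ k′ˣ` ARBITRARY,
>   `J₀ = (u-multiples of weight > 45) = (ut⁴, ust³, us²t², us⁴t, us⁶, u²t², u²st, u²s³, u³t, u³s, u⁴)` = `faceRootJ`,
>   `J^B₀ = (u-multiples of weight ≥ 23) = (ut, us², u²)` = `faceRootJB`.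
>
> (No square roots are taken: `κ(y)` may be imperfect.  In characteristic 2 the term `B·Z` cannot be completed away — it is
> CARRIED, as the Artin–Schreier ideal `J^B`.)
>
> ## THE DECISION: EQUIRESOLUTION OF THE SUB-KIND ALONG g24's PILOT PACKAGE (NODE-g26 §3–§6)
>
> THEOREM (paper, NODE-g26; every finite check in this file's KERNEL).  For EVERY face-cusp point (any `ē ∈ (k′ˣ)³`,
any `T ∈ J₀`,
> `B ∈ J^B₀`, any residue field) g24's 40-node / 21-leaf toric package at `x̄` — read globally: 10 regular centres in 8 rounds
> (NODE-g24 §3.3: `x̄`; `C₂ = S̃ ∩ E₁`; `E₁∩E₂`, `S̃∩E₂`; `E₁∩E₃`, `E₂∩E₃`; the fibres `Ψ, Φ, Θ`; `A = E₂ ∩ E_Ψ`),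
all lying over
> `y` — is weakly admissible, and after it every point over `x̄` of order 2 has `τ ≥ 2`.  With the tower (centres
`C`, `Σ₁`: global,
>
> [… the lens header continues (58 more lines: the face tree / rule and its audit, the leaf lemma, why only (5,3),
the exact re-location and the honest tags, sources) in the HOME node file `HOME/decomp-res-lens-2/g26/FaceCut.lean`
lines 3–123 — not repeated here.]

## This file

§F.0 RING LEVEL — the face tree with tails (`section FaceRing`, any commutative ring; 0 hypothesis beyond `2 = 0`
where stated): §F.0a THE FACE TREE AS DATA and its AUDIT by `decide` (`FMono`, `FaceNode`, `faceTree`,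
`faceNodeCheck`, `faceCheck_eq_true`, the extras `faceExtras*` / `faceCheckExtra_*` — transport of the tail ideals,
permissibility, leaf orders); §F.0b THE 39 CHART IDENTITIES WITH UNIT-SQUARE COEFFICIENTS `face_e0` … `face_e38`
(the face part of every controlled transform); §F.0b′ TRANSPORT OF AN ARBITRARY TAIL / ARTIN–SCHREIER MONOMIAL
`transport_*`; §F.0c THE 56 LEAF CERTIFICATES `face_leaf*` — tail-robust and Artin–Schreier-aware (NODE-g26 §4, Leaf
Lemma); §F.0d THE DICTIONARY IDENTITIES `face_tower` / `face_towerMonomial` / `face_weight_iff`,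
`insepV3_faceLetter` / `insepV3_faceRoot` (INSEP-v³ reads the face letter with `e = (1,1,1)`, tail `0`).  Continued
in `FaceCutKernels2`… where the 400-line cap cuts.  (The 400-line cap cuts this group into 4 files; this first part
carries: `FMono`, `FMono.get`, `FMono.set`, `FMono.dvd`, `FMono.degA`, `FMono.odd`, `fInIdeal`, `tmapT`, `tmapB`,
`fMinExp`, `FaceNode`.)

[WRITER NOTE (decomp-res writer g13): file split only (tree files ≤ 400 lines); sections, section variables / opens
and every declaration exactly as in the lens (the node's two HOME-only lines `linter.style.longFile` /
dupNamespace-linter are dropped; the namespace-level `open` lines of the node are replayed in every part, the `open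
…Theses` line only in the Theses-cone file `MaxContactCutFaceCut`); namespace renamed `…Theses.FaceCut` ↦
`…Theorems.FaceCut`; the cone-free parts import `…Theorems.CuspCutCells2` (the landed g24 cells) instead of the g24
wiring file, which only the cone file imports.]

(Sources: Hironaka1964 Ch. III §§1–3; CossartJannsenSaito2020 Ch. 2, Ch. 8–9; Matsumura1987 Thm 28.3, §29;
Cohen1946; ZariskiSamuelII Ch. VII §1; Bourbaki AC VII §3; CossartPiltant2008 Prop. 4.2, Lemma 4.3; Moh1987;
Hauser2010Kangaroo; BierstoneGrigorievMilmanWlodarczyk2011 §3; Cutkosky2009.)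
-/

open CategoryTheory AlgebraicGeometry TopologicalSpace IsLocalRing
open Literature.AlgebraicGeometry.Resolution
open Summit.ResolutionOfSingularities.ResolutionOfSingularities.Theorems
open Summit.ResolutionOfSingularities.ResolutionOfSingularities.Theorems.WeakOrderReduction
open Summit.ResolutionOfSingularities.ResolutionOfSingularities.Theorems.DeltaFaceCutClasses
open Summit.ResolutionOfSingularities.ResolutionOfSingularities.Theorems.RelativeDeltaCut
open Summit.ResolutionOfSingularities.ResolutionOfSingularities.Theorems.CurveLeafExit
open Summit.ResolutionOfSingularities.ResolutionOfSingularities.Theorems.PinchCut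
open Summit.ResolutionOfSingularities.ResolutionOfSingularities.Theorems.JetCut
open Summit.ResolutionOfSingularities.ResolutionOfSingularities.Theorems.PurityCut
open Summit.ResolutionOfSingularities.ResolutionOfSingularities.Theorems.SplitCut
open Summit.ResolutionOfSingularities.ResolutionOfSingularities.Theorems.CylinderCut
open Summit.ResolutionOfSingularities.ResolutionOfSingularities.Theorems.SpreadCut
open Summit.ResolutionOfSingularities.ResolutionOfSingularities.Theorems.CrossCut
open Summit.ResolutionOfSingularities.ResolutionOfSingularities.Theorems.DeepCrossCut
open Summit.ResolutionOfSingularities.ResolutionOfSingularities.Theorems.OddCrossCut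
open Summit.ResolutionOfSingularities.ResolutionOfSingularities.Theorems.CuspCut

namespace Summit.ResolutionOfSingularities.ResolutionOfSingularities.Theorems.FaceCut

section FaceRing

variable {R : Type} [CommRing R]

/-! ## §F.0  RING LEVEL — the face tree with tails (0 sorry, 0 hypothesis beyond `2 = 0` where stated) -/

/-! ### §F.0a  THE FACE TREE AS DATA and its AUDIT by `decide` (transport of the tail ideals, permissibility, leaf orders)

The 40 nodes `ν0 … ν39` of g24's pilot tree (DFS order of NODE-g24 §3 / `section Pilot`), each carrying: its parent edge
`(parent, centre A, chart j)`, the blow-up `centre` performed AT the node (`none` = leaf), the three face monomials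
`F0 = [m_a, m_b, m_c]` (descendants of `u³, us⁵, ut³`; coefficients `a = d₀², b = d₁², c = d₂²` ride along unchanged), minimal
generators of the TAIL IDEAL `J_ν` and of the ARTIN–SCHREIER IDEAL `J^B_ν` (monomial ideals in the chart coordinates), the
boundary `Λ_ν` (coordinate hyperplanes through the chart origin) and the flag `hasS` («`{u = 0}` is the strict transform `S̃` of
`Σ_q`, not exceptional»).  Exponent vectors are `(e_u, e_s, e_t)`.  TRANSPORT LAW (NODE-g26 §3): blowing up `V(Z, x_A)`, chart
`x_j`: a tail monomial `e ↦ e` with `e_j := Σ_{i∈A} e_i − 2` (`tmapT`), an Artin–Schreier monomial with `e_j := Σ_{i∈A} e_i − 1`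
(`tmapB`).  `faceCheck` verifies, for every node: (T) the parent's generators land in the child's ideals and `F0` maps to `F0`;
(C) every chart `j ∈ A` of every centre is a node (coverage) and `Λ`, `hasS` propagate correctly; (P) at internal nodes
`J_ν ⊆ I_A²`, `J^B_ν ⊆ I_A`, `F0 ⊆ I_A²`, `|A| ≥ 2` (permissibility of `V(Z, x_A)` CHART-GLOBALLY, and the `Z`-chart lemma);
(O) no face monomial ever becomes a square; (L) at leaves, for every EXCEPTIONAL component `E = {x = 0} ∈ Λ_ν`: tails lie in
`(x^r)` with `r ≥ 2` on carriers (`x ∣ F0`) and `r ≥ 1` otherwise — the order hypotheses of the leaf certificates §F.0c, whose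
`(r, r_B)` are read off this table.  PURE ARITHMETIC, kernel-checked by `decide`. -/

/-- Exponent vector `(e_u, e_s, e_t)`. -/
abbrev FMono := ℕ × ℕ × ℕ

/-- Coordinate `i` of an exponent vector. -/
def FMono.get (e : FMono) (i : Fin 3) : ℕ := if i = 0 then e.1 else if i = 1 then e.2.1 else e.2.2

/-- Set coordinate `i`. -/
def FMono.set (e : FMono) (i : Fin 3) (v : ℕ) : FMono :=
  if i = 0 then (v, e.2.1, e.2.2) else if i = 1 then (e.1, v, e.2.2) else (e.1, e.2.1, v)

/-- Monomial divisibility `x^g ∣ x^h`. -/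
def FMono.dvd (g h : FMono) : Bool := (g.1 ≤ h.1) && (g.2.1 ≤ h.2.1) && (g.2.2 ≤ h.2.2)

/-- `I_A`-degree `Σ_{i ∈ A} e_i`. -/
def FMono.degA (A : List (Fin 3)) (e : FMono) : ℕ := (A.map e.get).sum

/-- Not a square (some exponent odd). -/
def FMono.odd (e : FMono) : Bool := (e.1 % 2 == 1) || (e.2.1 % 2 == 1) || (e.2.2 % 2 == 1)

/-- Membership of a monomial in the monomial ideal generated by `G`. -/
def fInIdeal (G : List FMono) (h : FMono) : Bool := G.any fun g => g.dvd h

/-- Transport of a TAIL monomial: centre `V(Z, x_A)`, chart `x_j`, controlled transform divided by `x_j²`. -/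
def tmapT (A : List (Fin 3)) (j : Fin 3) (e : FMono) : FMono := e.set j (e.degA A - 2)

/-- Transport of an ARTIN–SCHREIER monomial (`B ↦ σ*B / x_j`). -/
def tmapB (A : List (Fin 3)) (j : Fin 3) (e : FMono) : FMono := e.set j (e.degA A - 1)

/-- Least `x`-exponent among generators (`99` if none). -/
def fMinExp (G : List FMono) (x : Fin 3) : ℕ := (G.map fun g => g.get x).foldr min 99

/-- One node of the face tree (fields in the module docstring of §F.0a). -/
structure FaceNode where
  parent : Option (ℕ × List (Fin 3) × Fin 3)
  centre : Option (List (Fin 3))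
  F0 : List FMono
  J : List FMono
  JB : List FMono
  Λ : List (Fin 3)
  hasS : Bool

end FaceRing

end Summit.ResolutionOfSingularities.ResolutionOfSingularities.Theorems.FaceCut
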